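import Summits.ResolutionOfSingularities.ResolutionOfSingularities.Theorems.FrobeniusClosingSteerWords30SigmaLeafParS

/-!
# Crux `Steer` (stmt-ResolutionOfSingularities-16345), line `switching-dichotomy` — WORDS 31A: §σ2.29 r43 THE `c = 3` GEOMETRIC RE-CUT, part A (HOIST of the registered skeleton r52 5a09c4c2f84a0135, l.2222–2444, inside `section HeightSplitTwo` with its `variable {K : Type} [Field K]`)

Holder res-L0-w41-lead-1 g6 on res-L0-w41-plan-1 RULING 47 (E1) / 104b; see `…Words01Core` for the hoist protocol (bodies byte for byte;
`[cite: …]` / `[folklore]` tags on CLOSED `def … : Prop` words are written «(ref. …)» / «(folklore)» — GATE NOTE of `…Words02Stubs`;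
cite keys inside `[cite:]` tags normalised to `references.bib` keys where needed, as in `…Words03Phases`).
Nothing here is a statement of the manuscript [claim: Hironaka2017, status: under-review]. OURS (candidates / vocabulary; AI review is
weaker than expert review).
-/

open Summit.ResolutionOfSingularities.ResolutionOfSingularities.Theses.FrobeniusClosing (IsolatedForcedTermination)
open Literature.AlgebraicGeometry.Resolution (IsAbhyankarPlace FGOver exists_ringKrullDim_eq_and_trdeg_eq
  trdeg_eq_trdeg_of_isFractionRing locAtCentre IsQuadraticTransformAlong SubringDominates IsRsopPart
  LocalUniformization3 RelLocalUniformization CossartPiltant2019General)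
open Summit.ResolutionOfSingularities.ResolutionOfSingularities.Theorems.SteerRankThinness
  (HasProperCoarsening concl_of_hasProperCoarsening rankOne_of_not_hasProperCoarsening)
open Summit.ResolutionOfSingularities.ResolutionOfSingularities.Theorems.PfaffLine

set_option linter.dupNamespace false

namespace Summit.ResolutionOfSingularities.ResolutionOfSingularities.Theorems.SwitchingDichotomy.Words

section SteeredTwo

open IsLocalRing
open Literature.AlgebraicGeometry.Resolution (IsLocalBlowupAlong IsQuadraticTransform IsExcellentRing)

variable {K : Type} [Field K]


/-! #### §σ2.29 r43 — THE `c = 3` GEOMETRIC RE-CUT (res-L0-w41-strat-2 g2 pen on plan-1 RULINGS 144 (iii) / 152a; words `GeomChainWords.lean`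
2bf798d920f2cc81 audited res-L0-w41-tri-2 v19 PASS ddf5709c4247b324, + the COHEIGHT-ONE tightening of 152a / tri-2 (N1)). APPEND-ONLY: no line of r42 abfe507e31d3365c is edited.
(1) **(hG3, hW3) ↦ hGW3** `∀ e ≥ 2, NoEternalConstOrderIsolatedChainGeom 2 3 (2e)`: every `c = 3` chain the T-line meets comes out of F-A3's engine as
LOCAL CHARTS `(R j)_Q`, `ht Q = 3 < 4`, of members of the run — geometric charts of positive relative dimension over the perfect ground field, never
residually perfect (§17.1; tri-2 v19 (1)), so `hG3` never bites. Typed: words (W1)–(W3) VERBATIM; (W4) the K♭ v2.2 GEOMETRIC currency `…ChainHG`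
(tri-2 v19 (N3)); its reduction ⟸ (B2) ∧ (C) ∧ G-geom(c, p·e) (`…H_of_constOrder` with ONE more binder threaded to the tail); (W5) F-A3 in that currency
`StrippedThreadTwoNHG` = the WORK binder `hA3` of the new T-line = res-D-pv-003's ENGINE EDIT (144 (iii)), fed BY NAME when it lands.
(2) **the height split made currency-free**: (X) `NoStrippedThreadTwoN` (F-A3's binders ⟹ `False`); `highWanderConclTwoN_of_heightSplitX` =
`…heightSplitH₂` VERBATIM except the five-line `hA3 / interval_cases / hS2 / hS3` block ↦ `exact hX …`; producers `noStrippedThreadTwoN_of_H` (r41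
currency; `…slate2H₂_via_X` shows r41's chain factors through (X)) and `…_of_HG`. A future re-typing of the K♭ currency costs a 3-line producer.
(3) (ρ₀) is r42's (RULING 151a): the new T-line keeps `hB₂ʰ hC₂ʰ : Birth/BranchWanderHighConclTwoN`; `…_of_toric` stay sufficient producers (`…slate13_toric`).
T-LINE CANDIDATE `eternalSteeredRunTwo_of_slate13`: 11 binders = FRONTIER {hB₂ʰ, hC₂ʰ, hK4′, hEv, hNS, hGW3} · WORK {hNT4, hARᵒ, hA3} · FACTS {hL′, hCP′};
↦ 10 when `hA3 : StrippedThreadTwoNHG` is fed by name (res-D-pv-003's 144 (iii) / 152a engine theorem; its tree word and (W5) must have the same body). Feeders: `hGW3` ⟸ (hG3, hW3) (`…Geom_of_pieces`); ⟸ hW3 alone modulo (K-rank) `GeomChartResidueImperfect 2`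
(`…Geom_of_W`, kernel target RULING 149b (i)). OURS; candidates, not facts. [folklore] -/

/-- **(W1) IsGeomChart A Q S** (VERBATIM `GeomChainWords.lean` 2bf798d920f2cc81): `S ⊆ L` is the local chart of the `k`-subalgebra `A ⊆ L` at its
prime `Q` (`z ∈ S ↔ z = a / b`, `a b ∈ A`, `b ∉ Q`) — res-D-pv-003's / res-type-096's `locChar` shape. OURS. [folklore] -/
def IsGeomChart {k L : Type} [Field k] [Field L] [Algebra k L] (A : Subalgebra k L) (Q : Ideal A) (S : Subring L) : Prop :=
  ∀ z : L, z ∈ S ↔ ∃ a b : A, b ∉ Q ∧ z = (a : L) / (b : L)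

/-- **(W2′) G-geom(c, d) · NoEternalConstOrderIsolatedChainGeom** (`GeomChainWords.lean` 2bf798d920f2cc81 (W2) + the COHEIGHT-ONE clause
`ringKrullDim (A ⧸ Q) = 1` ADOPTED by plan-1 RULING 152a on tri-2 v19 (N1) — F-A3's engine delivers `ht Q = 3` in a 4-dimensional member;
FRONTIER at `c = 3`, the re-cut slot of RULING 144 (iii)): G(c, d) with ONE extra member binder — every member is a geometric chart of relative
dimension ONE (`Q` of coheight one, in particular not maximal) of a finitely generated algebra over a perfect `k ⊆ L`. Contains every `c = 3` chain of the T-line; disjoint from `hG3`'s class modulo (K-rank).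
Why it might fail: it is `hW3` on geometric members — inseparable residue steps along the thread remain (§17.3; idea-3 LEMMA I). OURS.
[cite: CossartPiltant2019, Thm. 1.5 (i)] [folklore] -/
def NoEternalConstOrderIsolatedChainGeom (p c d : ℕ) : Prop :=
  ∀ (k L : Type) [Field k] [PerfectField k] [Field L] [CharP L p] [Algebra k L]
    (S : ℕ → Subring L) [∀ m, IsLocalRing (S m)]
    (hle : ∀ m, S m ≤ S (m + 1)) (f g : ∀ m, S m) (x : ∀ m, S (m + 1)),
    (∀ m, ∃ (A : Subalgebra k L) (Q : Ideal A), A.FG ∧ Q.IsPrime ∧ (∃ Q' : Ideal A, Q'.IsPrime ∧ Q < Q') ∧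
      IsGeomChart A Q (S m)) →
    (∀ m, IsRegularLocalRing (S m)) → (∀ m, IsExcellentRing (S m)) → (∀ m, ringKrullDim (S m) = c) →
    (∀ m, IsQuadraticTransform (S m) (S (m + 1))) →
    (∀ m, Ideal.span ((fun y : S m => (⟨(y : L), hle m y.2⟩ : S (m + 1))) '' (maximalIdeal (S m) : Set (S m)))
        = Ideal.span {x m}) →
    (∀ m, ((f (m + 1) : S (m + 1)) : L) * ((x m : S (m + 1)) : L) ^ d =
        ((f m : S m) : L) - ((g m : S m) : L) ^ p) →
    (∀ m, ∃ h : S m, f m - h ^ p ∈ maximalIdeal (S m) ^ p) →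
    (∀ m (h : S m), f m - h ^ p ∉ maximalIdeal (S m) ^ (d + 1)) →
    (∀ m, HasCleaningDerivations p (S m) (f m) (g m)) →
    (∀ m, HasIsolatedSingularity (RadicandRing (S m) p (f m))) →
    False

/-- **(W3) (K-rank) · GeomChartResidueImperfect** (VERBATIM `GeomChainWords.lean` 2bf798d920f2cc81; kernel fact wanted, M−, RULING 149b (i); tri-2
v19 (2): TRUE — `Frac(A ⧸ Q)` f.g. of `trdeg ≥ 1` over the perfect `k` ⇒ `[F : F^p] = p^trdeg`): the residue field of a geometric chart of positive
relative dimension in characteristic `p` is NOT perfect. Consumed ONLY by the feeder `…Geom_of_W` (hW3 alone ⟹ hGW3). OURS. [folklore] -/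
def GeomChartResidueImperfect (p : ℕ) : Prop :=
  ∀ (k L : Type) [Field k] [PerfectField k] [CharP k p] [Field L] [Algebra k L], p.Prime →
    ∀ (A : Subalgebra k L) (Q : Ideal A) (S : Subring L) [IsLocalRing S],
      A.FG → Q.IsPrime → (∃ Q' : Ideal A, Q'.IsPrime ∧ Q < Q') → IsGeomChart A Q S →
      ¬ PerfectField (ResidueField S)

/-- G-geom ⟸ G (drop the geometric binder). Pure logic (tri-2 v19 `Tri2Probe.geom_of_G`). OURS. [folklore] -/
theorem noEternalConstOrderIsolatedChainGeom_of {p c d : ℕ} (h : NoEternalConstOrderIsolatedChain p c d) :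
    NoEternalConstOrderIsolatedChainGeom p c d :=
  fun _ L _ _ _ _ _ S _ hle f g x _ hreg hexc hdim hqt hspan hlaw hmult hopt hH hiso =>
    h L S hle f g x hreg hexc hdim hqt hspan hlaw hmult hopt hH hiso

/-- **hGW3's feeder from the r41 pair**: G-geom(c, d) ⟸ G-perf(c, d) ∧ W(c, d). Pure logic. OURS. [folklore] -/
theorem noEternalConstOrderIsolatedChainGeom_of_pieces {p c d : ℕ}
    (hP : NoEternalConstOrderIsolatedChainPerfect p c d) (hW : NoEternalConstOrderIsolatedChainImperfect p c d) :
    NoEternalConstOrderIsolatedChainGeom p c d :=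
  noEternalConstOrderIsolatedChainGeom_of (noEternalConstOrderIsolatedChain_of_perfect_of_imperfect hP hW)

/-- **hGW3's feeder from hW3 ALONE modulo (K-rank)** (§17.1 in checkable form; tri-2 v19 `Tri2Probe.geom_of_W`): on a geometric chain member `0`
witnesses the imperfectness binder of W. The `CharP k p` / `CharP L p` mismatch is bridged by `Algebra.charP_iff`. OURS. [folklore] -/
theorem noEternalConstOrderIsolatedChainGeom_of_W {p c d : ℕ} (hK : GeomChartResidueImperfect p) (hp : p.Prime)
    (h : NoEternalConstOrderIsolatedChainImperfect p c d) : NoEternalConstOrderIsolatedChainGeom p c d := by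
  intro k L _ _ _ _ _ S _ hle f g x hgeom hreg hexc hdim hqt hspan hlaw hmult hopt hH hiso
  haveI : CharP k p := (Algebra.charP_iff k L p).mpr inferInstance
  refine h L S hle f g x hreg hexc hdim hqt hspan hlaw hmult hopt hH ?_ hiso
  intro hperf
  obtain ⟨A, Q, hA, hQ, hQ', hS⟩ := hgeom 0
  exact hK k L hp A Q (S 0) hA hQ hQ' hS (hperf 0)

/-- **(W4) K♭ v2.2 in the GEOMETRIC currency · NoEternalStrippedRadicandChainHG** (FRONTIER at `c = 3` modulo (B2), (C) and G-geom(3, 2e);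
tri-2 v19 (N3)): K♭ v2.2 `NoEternalStrippedRadicandChainH` VERBATIM over a perfect ground field `k ⊆ L` with ONE added member binder — the
geometric-chart binder of (W2), VERBATIM. Weaker than K♭ v2.2 (`…HG_of_H`). This is the currency F-A3's engine can actually deliver at `c = 3`
(its members are local charts of the run). OURS. [cite: CossartPiltant2019, Thm. 1.5 (i)] [folklore] -/
def NoEternalStrippedRadicandChainHG (p c : ℕ) : Prop :=
  ∀ (k L : Type) [Field k] [PerfectField k] [Field L] [CharP L p] [Algebra k L]
    (S : ℕ → Subring L) [∀ m, IsLocalRing (S m)]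
    (hle : ∀ m, S m ≤ S (m + 1)) (f g : ∀ m, S m) (x : ∀ m, S (m + 1)) (e : ℕ → ℕ) (_he : ∀ m, 1 ≤ e m)
    (_hinf : ∀ m₀, ∃ m, m₀ ≤ m ∧ 2 ≤ e m),
    (∀ m, ∃ (A : Subalgebra k L) (Q : Ideal A), A.FG ∧ Q.IsPrime ∧ (∃ Q' : Ideal A, Q'.IsPrime ∧ Q < Q') ∧
      IsGeomChart A Q (S m)) →
    (∀ m, IsRegularLocalRing (S m)) → (∀ m, IsExcellentRing (S m)) → (∀ m, ringKrullDim (S m) = c) →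
    (∀ m, IsQuadraticTransform (S m) (S (m + 1))) →
    (∀ m, Ideal.span ((fun y : S m => (⟨(y : L), hle m y.2⟩ : S (m + 1))) '' (maximalIdeal (S m) : Set (S m)))
        = Ideal.span {x m}) →
    (∀ m, ((f (m + 1) : S (m + 1)) : L) * ((x m : S (m + 1)) : L) ^ (p * e m) =
        ((f m : S m) : L) - ((g m : S m) : L) ^ p) →
    (∀ m, ∃ h : S m, f m - h ^ p ∈ maximalIdeal (S m) ^ p) →
    (∀ m, HasCleaningDerivations p (S m) (f m) (g m)) →
    (∀ m, HasIsolatedSingularity (RadicandRing (S m) p (f m))) →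
    False

/-- K♭ v2.2 ⟹ K♭ v2.2-geometric (drop the geometric binder). Pure logic. OURS. [folklore] -/
theorem noEternalStrippedRadicandChainHG_of_H {p c : ℕ} (h : NoEternalStrippedRadicandChainH p c) :
    NoEternalStrippedRadicandChainHG p c :=
  fun _ L _ _ _ _ _ S _ hle f g x e he hinf _ hreg hexc hdim hqt hspan hlaw hmult hH hiso =>
    h L S hle f g x e he hinf hreg hexc hdim hqt hspan hlaw hmult hH hiso

/-- **§σ2.26 v2 REDUCTION in the GEOMETRIC currency** (PROVED; `noEternalStrippedRadicandChainH_of_constOrder` VERBATIM with the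
geometric member binder threaded to the tail — tri-2 v19 (N3)): K♭ v2.2-geometric (c) ⟸ (B2) `DerivationStepTransfer` ∧ (C) `CleaningExact` ∧
G-geom(c, p·e) for all `e ≥ 2`, `c ≥ 3`, `p` prime. OURS. [folklore] -/
theorem noEternalStrippedRadicandChainHG_of_constOrderGeom {p c : ℕ} (hp : p.Prime) (hc : 2 < c)
    (hB2 : DerivationStepTransfer p c) (hCE : CleaningExact p c)
    (hG : ∀ e : ℕ, 2 ≤ e → NoEternalConstOrderIsolatedChainGeom p c (p * e)) :
    NoEternalStrippedRadicandChainHG p c := by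
  intro k L _ _ _ _ _ S _ hle f g x e he hinf hgeom hreg hexc hdim hqt hspan hlaw hmult hH hiso
  have hp2 : 2 ≤ p := hp.two_le
  -- (C) at every stage: the full strip is exact
  have hC : ∀ m, f m - g m ^ p ∈ maximalIdeal (S m) ^ (p * e m) ∧
      ∀ h : S m, f m - h ^ p ∉ maximalIdeal (S m) ^ (p * e m + 1) := fun m =>
    hCE hc L (S m) (S (m + 1)) (hle m) (f m) (g m) (f (m + 1)) (x m) (e m) hp (he m) (hreg m) (hreg (m + 1))
      (hexc m) (hexc (m + 1)) (hdim m) (hdim (m + 1)) (hqt m) (hspan m) (hlaw m) (hmult (m + 1)) (hiso (m + 1))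
  have hDsub : ∀ m (D : Derivation ℤ (S m) (S m)), D (f m - g m ^ p) = D (f m) := fun m D => by
    rw [map_sub, derivation_subring_apply_pow_eq_zero p (S m) D (g m), sub_zero]
  have h1le : ∀ m, 1 ≤ p * e m := fun m => le_trans (by omega) (Nat.mul_le_mul hp2 (he m))
  -- (B2): the exponent never increases
  have hstep : ∀ m, e (m + 1) ≤ e m := by
    intro m
    obtain ⟨hmem, hopt⟩ := hC m
    obtain ⟨D, hD⟩ := hH m (p * e m) hopt hmem
    have hDf : D (f m) ∈ maximalIdeal (S m) ^ (p * e m - 1) := by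
      rw [← hDsub m D]
      refine derivation_apply_mem_pow_of_mem_pow_succ D _ (p * e m - 1) ?_
      rw [Nat.sub_add_cancel (h1le m)]
      exact hmem
    have hν : ∃ ν : ℕ, D (f m) ∈ maximalIdeal (S m) ^ ν ∧ D (f m) ∉ maximalIdeal (S m) ^ (ν + 1) ∧
        (p * e m = ν + 1 ∨ (p * e m = ν ∧ ∀ y ∈ maximalIdeal (S m), D y ∈ maximalIdeal (S m))) := by
      rcases hD with hD | ⟨hlog, hD⟩
      · refine ⟨p * e m - 1, hDf, ?_, Or.inl (Nat.sub_add_cancel (h1le m)).symm⟩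
        rw [Nat.sub_add_cancel (h1le m)]
        exact hD
      · by_cases hmid : D (f m) ∈ maximalIdeal (S m) ^ (p * e m)
        · exact ⟨p * e m, hmid, hD, Or.inr ⟨rfl, hlog⟩⟩
        · refine ⟨p * e m - 1, hDf, ?_, Or.inl (Nat.sub_add_cancel (h1le m)).symm⟩
          rw [Nat.sub_add_cancel (h1le m)]
          exact hmid
    obtain ⟨ν, hν1, hν2, hν3⟩ := hν
    have hνle : ν ≤ p * e m := by
      rcases hν3 with h | ⟨h, _⟩ <;> omega
    obtain ⟨D₁, hD₁⟩ := hB2 L (S m) (S (m + 1)) (hle m) (f m) (g m) (f (m + 1)) (x m) (e m) hp (he m) (hreg m)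
      (hreg (m + 1)) (hdim m) (hdim (m + 1)) (hqt m) (hspan m) (hlaw m) ν ⟨D, hν1, hν2, hν3⟩
    obtain ⟨hmem1, -⟩ := hC (m + 1)
    have hD₁f : D₁ (f (m + 1)) ∈ maximalIdeal (S (m + 1)) ^ (p * e (m + 1) - 1) := by
      rw [← hDsub (m + 1) D₁]
      refine derivation_apply_mem_pow_of_mem_pow_succ D₁ _ (p * e (m + 1) - 1) ?_
      rw [Nat.sub_add_cancel (h1le (m + 1))]
      exact hmem1
    refine not_lt.mp fun hlt => hD₁ (Ideal.pow_le_pow_right ?_ hD₁f)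
    have hmul : p * (e m + 1) ≤ p * e (m + 1) := Nat.mul_le_mul_left p (Nat.succ_le_of_lt hlt)
    rw [mul_add_one] at hmul
    have h1 := h1le (m + 1)
    generalize p * e m = a at hνle hmul
    generalize p * e (m + 1) = b at hmul h1
    omega
  have hanti : ∀ m n : ℕ, e (m + n) ≤ e m := by
    intro m n
    induction n with
    | zero => exact le_rfl
    | succ n ih => exact (hstep (m + n)).trans ih
  classical
  have hP : ∃ v : ℕ, ∃ m, e m = v := ⟨e 0, 0, rfl⟩
  obtain ⟨m₀, hm₀⟩ := Nat.find_spec hP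
  have hmin : ∀ m, Nat.find hP ≤ e m := fun m => Nat.find_min' hP ⟨m, rfl⟩
  have hconst : ∀ n, e (m₀ + n) = Nat.find hP := fun n => le_antisymm ((hanti m₀ n).trans hm₀.le) (hmin _)
  obtain ⟨m, hm, h2⟩ := hinf m₀
  have hv2 : 2 ≤ Nat.find hP := by
    obtain ⟨n, rfl⟩ := Nat.exists_eq_add_of_le hm
    exact h2.trans (hconst n).le
  haveI : ∀ n, IsLocalRing ((fun n => S (m₀ + n)) n) := fun n => inferInstance
  refine hG (Nat.find hP) hv2 k L (fun n => S (m₀ + n)) (fun n => hle (m₀ + n)) (fun n => f (m₀ + n)) (fun n => g (m₀ + n))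
    (fun n => x (m₀ + n)) (fun n => hgeom (m₀ + n)) (fun n => hreg (m₀ + n)) (fun n => hexc (m₀ + n)) (fun n => hdim (m₀ + n))
    (fun n => hqt (m₀ + n)) (fun n => hspan (m₀ + n)) (fun n => ?_) (fun n => hmult (m₀ + n))
    (fun n h => ?_) (fun n => hH (m₀ + n)) (fun n => hiso (m₀ + n))
  · have hl := hlaw (m₀ + n)
    rw [hconst n] at hl
    exact hl
  · have ho := (hC (m₀ + n)).2 h
    rw [hconst n] at ho
    exact ho

/-- **hS3 at `p = 2` in the geometric currency from hGW3** — the `c = 3` slot of the re-cut T-line: K♭ v2.2-geometric (2, 3) ⟸ G-geom(3, 2e), `e ≥ 2`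
((B2), (C) by res-type-096's leaves, as in `…H_two_three_of_pieces`). Pure logic. OURS. [folklore] -/
theorem noEternalStrippedRadicandChainHG_two_three_of_geom
    (hGW3 : ∀ e : ℕ, 2 ≤ e → NoEternalConstOrderIsolatedChainGeom 2 3 (2 * e)) :
    NoEternalStrippedRadicandChainHG 2 3 :=
  noEternalStrippedRadicandChainHG_of_constOrderGeom Nat.prime_two (by norm_num) (derivationStepTransfer_holds 2 3)
    (cleaningExact_holds 2 3) hGW3

/-- **(W5′) F-A3 in the MIXED currency · StrippedThreadTwoNHG** (plan-1 RULINGS 156a / 160b (1) on res-D-pv-003's finding 14:21:24Z: the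
`c = 2` thread members have coheight `2 = 4 − c` (intrinsic), so the engine delivers `¬ K♭H p 2` there and the GEOMETRIC chart datum (coheight
one) only at `c = 3 = n − 1`; r43's uniform «`∃ c, 2 ≤ c ≤ 3 ∧ ¬ K♭HG p c`» is superseded by the filed engine p539326's shape. CLOSED below by
`strippedThreadTwoNHG_holds` (§σ2.30). Formerly: WORK — res-D-pv-003's ENGINE EDIT, RULING 144 (iii): the engine
`StrippedThread.exists_not_noEternalStrippedChainH_of_infinitelyHit` already holds, per member, the chart datum `hloc m` (members `S m` = local
charts of `R (j′(m+1))` at the centre prime) and the model `A₁` (`GeoDict.essFiniteType_of_locChar`); exposing `IsGeomChart A Q (S m)` with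
`Q < Q′` (height `c < 4`) in the refuting instantiation gives this word at `c = 3` — tri-2 v19 (N3)): `StrippedThreadTwoNH`'s binders VERBATIM ⇒
`¬ K♭H p 2 ∨ ¬ K♭HG p 3`. STRONGER than `StrippedThreadTwoNH` (`strippedThreadTwoNH_of_HG`). OURS. (folklore) -/
def StrippedThreadTwoNHG : Prop :=
  ∀ p : ℕ, p = 2 →
    ∀ (k K : Type) [Field k] [CharP k p] [PerfectField k] [Field K] [Algebra k K]
    (O : ValuationSubring K) (A₀ : Subalgebra k K) (h₀ : A₀.toSubring ≤ O.toSubring) (t : K),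
    CoreDatum p 4 k K O A₀ h₀ t → ¬ HasProperCoarsening O →
    ∀ (R : ℕ → Subring K) (P : (i : ℕ) → Ideal (R i)) (s : ℕ → K),
      R 0 = locAtCentre A₀.toSubring O → NormalAt O (R 0) p t → IsSteeredRun O R P t p s →
      (¬ ∃ i₀ c : ℕ, 1 ≤ c ∧ IsDominantTail R P i₀ c) →
      (∃ i₀ : ℕ, ∀ i, i₀ ≤ i → IsHighOrderAt R s p i) →
      ∀ J : Set ℕ, J.Infinite → (∀ i ∈ J, ∀ j ∈ J, i < j → IsAncestorStep R P i j) →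
        (∀ j ∈ J, 2 ≤ (P j).height) → IsFinitelyHitTwo R P J → ¬ IsFinitelyHit R P J →
        (¬ NoEternalStrippedRadicandChainH p 2) ∨ (¬ NoEternalStrippedRadicandChainHG p 3)

/-- F-A3′ (W5′) ⟹ F-A3 (v2.2): the `c = 2` disjunct is the v2.2 word verbatim; a chain violating K♭ v2.2-geometric at `c = 3` violates
K♭ v2.2 there (`…HG_of_H`). Pure logic. OURS. [folklore] -/
theorem strippedThreadTwoNH_of_HG (h : StrippedThreadTwoNHG) : StrippedThreadTwoNH := by
  intro p hp2 k K _ _ _ _ _ O A₀ h₀ t core hrk R P s hR0 hN hrun hnd hhigh J hJ hA hJ2 hfin2 hfin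
  rcases h p hp2 k K O A₀ h₀ t core hrk R P s hR0 hN hrun hnd hhigh J hJ hA hJ2 hfin2 hfin with h2 | h3
  · exact ⟨2, le_rfl, by norm_num, h2⟩
  · exact ⟨3, by norm_num, le_rfl, fun hH => h3 (noEternalStrippedRadicandChainHG_of_H hH)⟩


end SteeredTwo

end Summit.ResolutionOfSingularities.ResolutionOfSingularities.Theorems.SwitchingDichotomy.Words
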